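import Summits.Ventures.CertifiedArithmetic.LowPrec.SRPythagorasBoundedJump
import HarnessLib

/-!
# Stochastic rounding in low-precision formats, CX: the NOISE FUNCTIONAL — the mean-square error
# of limited-randomness SR is exactly noise + squared bias; the Pythagorean law follows from a
# noise budget (local or global) strictly weaker than drift-antitonicity

HONEST FRAMING: certified error envelopes and provably optimal rounding/accumulation schemes for
low-precision formats under stated cost models; every table by two implementations; no hardware or
vendor claims.

Setting of files LXI/XCII/CVII (`pUpQ`, `stepQ`, `accExpQ`: recursive summation on a finite value
set with a perturbed SR of away-probability `q(η)`, `|q − id| ≤ ε`).  Write the error as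
`ŝₙ − sₙ = M + R`, `M` the martingale part, `R = ∑ₖ βₖ` the accumulated CONDITIONAL bias
(`βₖ = E[ŝₖ₊₁ | ŝₖ] − (ŝₖ + xₖ)`, branch-dependent).
* `driftGap Δ(c)` (bias-to-go from `⌈c̄⌉` minus from `⌊c̄⌋`; `DriftAntitone` of XCII is `Δ ≤ 0`),
  `nodeNoise = π(1−π)·w·(w + 2Δ)`, `nodeBias2 = β² + 2β·E[bias-to-go]`, and the backward
  recursions `noiseQ` (`𝒩 = E[M² + 2MR]`), `bias2Q` (`ℬ = E[R²]`).
* **`accExpQ_sq_eq_noiseQ_add_bias2Q`: `E(ŝₙ − sₙ)² = 𝒩 + ℬ` EXACTLY** — every tree, rule, value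
  set (no hypotheses; `accExpQ_sq_split` at both candidates of every branch point).
* **`bias2Q_le`:** `NoSat ∧ GapLE G ⇒ ℬ ≤ (n·ε·G)²`.  **`accExpQ_sq_le_of_noiseQ_le`:**
  `𝒩 ≤ B ⇒ E(ŝₙ − sₙ)² ≤ B + (n·ε·G)²` — with `B = n·G²/4` the law of files LX/LXI/XCII from ONE
  decidable inequality per tree.
* `NoiseBudget F q G` (LOCAL: `nodeNoise ≤ G²/4` at every branch point; decidable,
  `noiseBudgetB`): **`noiseQ_le_of_noiseBudget`** (`⇒ 𝒩 ≤ n·G²/4`),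
  **`accExpQ_sq_le_of_noiseBudget`** (`⇒` the law); `stochasticA_acc_sq_le_of_noiseBudget` /
  `…_of_noiseQ_le`: IEEE P3109 `StochasticA`, `ε = 2^{-N}`.
* **`noiseBudget_of_driftAntitone`:** `GapLE G ∧ DriftAntitone ⇒ NoiseBudget G`, so XCII's theorem
  is the corollary `accExpQ_sq_le_of_driftAntitone'`; the budget is STRICTLY WEAKER — a node with
  `Δ > 0` passes as soon as `π(1−π)·w·(w + 2Δ) ≤ G²/4`: fine cells (`w < G`) pay for positive
  sibling drift with their unused variance budget.
* Kernel instances (`decide`): `Formats.threshold_witnesses_noiseBudget` — ALL SIX sharpness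
  witnesses of the bits threshold (XCIII/XCV/CVII: not drift-antitone, `JumpLE` violated) satisfy
  `NoiseBudget`, so the law holds on them BY THEOREM (`e3m2_superjump_certified_by_budget`);
  `Formats.e3m2_noiseBudget_fails_noiseQ_le` — TWO random bits, from `2` add `57/8, −53/8, 113/16`
  (window `[1, 12]`, `G = 2`): root `nodeNoise = 9/8 > 1 = G²/4` (`¬ NoiseBudget`) but
  `𝒩 = 105/64 ≤ 3`, law `439/256 ≤ 21/4` by the global criterion — at `N = 2` the certified classes
  are STRICTLY nested, `DriftAntitone ⊊ NoiseBudget ⊊ {𝒩 ≤ n·G²/4}`; equality `𝒩 = n·G²/4` (fair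
  coins, equal spacing): `Formats.e3m2_noiseQ_attains`.

NOT proved here, stated exactly: `𝒩 ≤ n·G²/4` for EVERY `StochasticA` tree on a one-signed nested
window.  Certificate gen20/noise (two implementations, byte-identical): the identity on every tree;
ZERO violations of `𝒩 ≤ n·G²/4` among 46 540 trees (`N = 1, 2, 3`: the 41 297 random trees of
gen19/jump incl. 4 938 super-jump trees, plus 5 243 adversarial zigzag trees shaped like the
instance above; max ratio `1`, fair coins in equally spaced sub-windows only); the LOCAL budget
holds on all 26 130 random-family trees with `N ≥ 2` but fails on 82 trees (zigzag/mixed, `N = 1,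
2, 3`), so a proof for all trees must be GLOBAL: `Δ > 0` at a coarse node needs roundings of the
lower sibling's subtree in cells finer by more than `N` binades (CVII's jumps, CVI's lever), which
under-spend the budget.  Conjecture NOISE-LE (THEOREMS-R3 §4ac; variance side: CXI), not claimed.
References: [ConnollyHighamMary2021] Lemma 6.3/Thm 6.4 (exact SR: `R = 0`, `𝒩 = E M²`);
[ElararEtAl2025, Lemma 3.3] (per-operation bias of `SR_{p,r}`); [XiaEtAl2022]; IEEE P3109 interim
report (`StochasticA/B/C`).  No source splits the accumulated MSE of a limited-randomness SR as
`E[M² + 2MR] + E[R²]` or states a noise-budget criterion (cell FRESHNESS-SR QUESTION U).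
-/

namespace Summit.Ventures.CertifiedArithmetic.LowPrec.SR

open Literature.ComputerArithmetic.ConnollyHighamMary2021
open Finset

variable {K : Type*} [Field K] [LinearOrder K] [IsStrictOrderedRing K]

namespace LimitedBits

/-- Sibling drift gap `Δ(c)` of the branch point `c` (remaining summands `x`, `n` more steps):
bias-to-go from the upper candidate minus bias-to-go from the lower one. -/
def driftGap (F : Finset K) (q : K → K) (x : ℕ → K) (n : ℕ) (c : K) : K :=
  (accExpQ F q x n (fun y => y) (up F c) - up F c)
    - (accExpQ F q x n (fun y => y) (dn F c) - dn F c)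

/-- NOISE produced at a branch point, `π(1−π)·w·(w + 2Δ)`: the conditional variance of the step
plus twice the covariance of its martingale increment with the bias accumulated after it. -/
def nodeNoise (F : Finset K) (q : K → K) (x : ℕ → K) (n : ℕ) (c : K) : K :=
  pUpQ F q c * (1 - pUpQ F q c) * (up F c - dn F c) * ((up F c - dn F c) + 2 * driftGap F q x n c)

/-- SQUARED BIAS produced at a branch point: `β² + 2β·b̄`, `β = E round(c) − c` the conditional step
bias, `b̄` the mean bias-to-go (each subtree about its own exact sum). -/
def nodeBias2 (F : Finset K) (q : K → K) (x : ℕ → K) (n : ℕ) (c : K) : K :=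
  (stepQ F q c (fun y => y) - c) ^ 2
    + 2 * (stepQ F q c (fun y => y) - c)
      * stepQ F q c (fun t => accExpQ F q x n (fun y => y) t - (t + ∑ i ∈ range n, x i))

/-- The NOISE FUNCTIONAL `𝒩 = E[M² + 2·M·R]` of the outcome tree, as a backward recursion. -/
def noiseQ (F : Finset K) (q : K → K) : (ℕ → K) → ℕ → K → K
  | _, 0, _ => 0
  | x, n + 1, s => nodeNoise F q (fun i => x (i + 1)) n (s + x 0)
      + stepQ F q (s + x 0) (noiseQ F q (fun i => x (i + 1)) n)

/-- The SQUARED-BIAS FUNCTIONAL `ℬ = E[R²]` (`R` the accumulated conditional bias). -/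
def bias2Q (F : Finset K) (q : K → K) : (ℕ → K) → ℕ → K → K
  | _, 0, _ => 0
  | x, n + 1, s => nodeBias2 F q (fun i => x (i + 1)) n (s + x 0)
      + stepQ F q (s + x 0) (bias2Q F q (fun i => x (i + 1)) n)

omit [IsStrictOrderedRing K] in
/-- **`E(ŝₙ − sₙ)² = 𝒩 + ℬ` exactly**, on every outcome tree of every rule `q` and every value set
(no hypotheses: the squared error split at both candidates of every branch point). -/
theorem accExpQ_sq_eq_noiseQ_add_bias2Q (F : Finset K) (q : K → K) :
    ∀ (x : ℕ → K) (n : ℕ) (s : K),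
      accExpQ F q x n (fun t => (t - (s + ∑ i ∈ range n, x i)) ^ 2) s
        = noiseQ F q x n s + bias2Q F q x n s := by
  intro x n
  induction n generalizing x with
  | zero => intro s; simp [accExpQ, noiseQ, bias2Q]
  | succ n ih =>
    intro s
    have hsum : s + ∑ i ∈ range (n + 1), x i = (s + x 0) + ∑ i ∈ range n, x (i + 1) := by
      rw [Finset.sum_range_succ']; ring
    simp only [hsum, noiseQ, bias2Q, nodeNoise, nodeBias2, driftGap]
    show stepQ F q (s + x 0) (accExpQ F q (fun i => x (i + 1)) n
      (fun t => (t - ((s + x 0) + ∑ i ∈ range n, x (i + 1))) ^ 2)) = _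
    set c := s + x 0
    set x' : ℕ → K := fun i => x (i + 1)
    set S' : K := ∑ i ∈ range n, x' i
    simp only [stepQ]
    rw [accExpQ_sq_split F q x' n (up F c) S' c, accExpQ_sq_split F q x' n (dn F c) S' c,
      ih x' (up F c), ih x' (dn F c)]
    ring

/-- **`ℬ ≤ (n·ε·G)²`** if `q` maps `[0,1]` into `[0,1]` with `|q − id| ≤ ε`, no branch saturates
and every candidate gap is `≤ G`. -/
theorem bias2Q_le (F : Finset K) {q : K → K} {ε G : K}
    (hq01 : ∀ η, 0 ≤ η → η ≤ 1 → 0 ≤ q η ∧ q η ≤ 1) (hq : ∀ η, 0 ≤ η → η ≤ 1 → |q η - η| ≤ ε) :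
    ∀ (x : ℕ → K) (n : ℕ) (s : K), NoSat F x n s → GapLE F G x n s →
      bias2Q F q x n s ≤ (n * (ε * G)) ^ 2 := by
  have hε : 0 ≤ ε := (abs_nonneg _).trans (hq 0 le_rfl zero_le_one)
  intro x n
  induction n generalizing x with
  | zero => intro s _ _; simp [bias2Q]
  | succ n ih =>
    rintro s ⟨hin, hnu, hnd⟩ ⟨hg0, hgu, hgd⟩
    have hcl : clamp F (s + x 0) = s + x 0 := clamp_eq_self hin
    have hγ : up F (s + x 0) - dn F (s + x 0) ≤ G := hg0
    have hγ0 : 0 ≤ up F (s + x 0) - dn F (s + x 0) := sub_nonneg.mpr (dn_le_up F _)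
    have hG : 0 ≤ G := hγ0.trans hγ
    have hεG : 0 ≤ ε * G := mul_nonneg hε hG
    have hfin : ((n : K) * (ε * G)) ^ 2 + ((ε * G) ^ 2 + 2 * ((ε * G) * (n * (ε * G))))
        = (↑(n + 1) * (ε * G)) ^ 2 := by push_cast; ring
    set c := s + x 0 with hc
    set x' : ℕ → K := fun i => x (i + 1) with hx'
    set S' : K := ∑ i ∈ range n, x' i with hS'
    have hBu := ih x' (up F c) hnu hgu
    have hBd := ih x' (dn F c) hnd hgd
    have hbu : |accExpQ F q x' n (fun t => t) (up F c) - (up F c + S')| ≤ n * (ε * G) :=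
      abs_accExpQ_id_sub_le F hq01 hq x' n (up F c) hnu hgu
    have hbd : |accExpQ F q x' n (fun t => t) (dn F c) - (dn F c + S')| ≤ n * (ε * G) :=
      abs_accExpQ_id_sub_le F hq01 hq x' n (dn F c) hnd hgd
    obtain ⟨hp0, hp1⟩ := pUpQ_mem F hq01 c
    have hβ : |stepQ F q c (fun t => t) - clamp F c| ≤ ε * G :=
      (abs_stepQ_id_sub_le F hq c).trans (mul_le_mul_of_nonneg_left hγ hε)
    rw [hcl] at hβ
    simp only [bias2Q, nodeBias2]
    simp only [stepQ] at hβ ⊢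
    set π := pUpQ F q c
    set u := up F c
    set d := dn F c
    set bu := accExpQ F q x' n (fun t => t) u - (u + S')
    set bd := accExpQ F q x' n (fun t => t) d - (d + S')
    set Bu := bias2Q F q x' n u
    set Bd := bias2Q F q x' n d
    set β := π * u + (1 - π) * d - c
    clear_value π u d bu bd Bu Bd β c x' S'
    have hT1 : π * Bu + (1 - π) * Bd ≤ (n * (ε * G)) ^ 2 := by
      have a1 := mul_le_mul_of_nonneg_left hBu hp0
      have a2 := mul_le_mul_of_nonneg_left hBd (sub_nonneg.mpr hp1)
      linarith
    have hbbar : |π * bu + (1 - π) * bd| ≤ n * (ε * G) :=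
      calc |π * bu + (1 - π) * bd| ≤ |π * bu| + |(1 - π) * bd| := abs_add_le _ _
        _ = π * |bu| + (1 - π) * |bd| := by
            rw [abs_mul, abs_mul, abs_of_nonneg hp0, abs_of_nonneg (sub_nonneg.mpr hp1)]
        _ ≤ π * (n * (ε * G)) + (1 - π) * (n * (ε * G)) :=
            add_le_add (mul_le_mul_of_nonneg_left hbu hp0)
              (mul_le_mul_of_nonneg_left hbd (sub_nonneg.mpr hp1))
        _ = n * (ε * G) := by ring
    have hT2 : β ^ 2 ≤ (ε * G) ^ 2 := sq_le_sq' (abs_le.mp hβ).1 (abs_le.mp hβ).2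
    have hT3 : β * (π * bu + (1 - π) * bd) ≤ (ε * G) * (n * (ε * G)) :=
      calc β * (π * bu + (1 - π) * bd) ≤ |β * (π * bu + (1 - π) * bd)| := le_abs_self _
        _ = |β| * |π * bu + (1 - π) * bd| := abs_mul _ _
        _ ≤ (ε * G) * (n * (ε * G)) := mul_le_mul hβ hbbar (abs_nonneg _) hεG
    linarith [hT1, hT2, hT3, hfin]

/-- **The Pythagorean law from a noise bound**: under the hypotheses of `bias2Q_le`, `𝒩 ≤ B` gives
`E(ŝₙ − sₙ)² ≤ B + (n·ε·G)²`.  With `B = n·G²/4` this is the law of files LX/LXI/XCII; the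
hypothesis is one decidable inequality per tree. -/
theorem accExpQ_sq_le_of_noiseQ_le (F : Finset K) {q : K → K} {ε G B : K}
    (hq01 : ∀ η, 0 ≤ η → η ≤ 1 → 0 ≤ q η ∧ q η ≤ 1) (hq : ∀ η, 0 ≤ η → η ≤ 1 → |q η - η| ≤ ε)
    (x : ℕ → K) (n : ℕ) (s : K) (hns : NoSat F x n s) (hgap : GapLE F G x n s)
    (hB : noiseQ F q x n s ≤ B) :
    accExpQ F q x n (fun t => (t - (s + ∑ i ∈ range n, x i)) ^ 2) s ≤ B + (n * (ε * G)) ^ 2 := by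
  rw [accExpQ_sq_eq_noiseQ_add_bias2Q]
  exact add_le_add hB (bias2Q_le F hq01 hq x n s hns hgap)

/-- `NoiseBudget F q G x n s`: at every branch point of the outcome tree the node noise is within
the exact-SR budget, `π(1−π)·w·(w + 2Δ) ≤ G²/4`. -/
def NoiseBudget (F : Finset K) (q : K → K) (G : K) : (ℕ → K) → ℕ → K → Prop
  | _, 0, _ => True
  | x, n + 1, s => nodeNoise F q (fun i => x (i + 1)) n (s + x 0) ≤ G ^ 2 / 4
      ∧ NoiseBudget F q G (fun i => x (i + 1)) n (up F (s + x 0))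
      ∧ NoiseBudget F q G (fun i => x (i + 1)) n (dn F (s + x 0))

/-- Boolean evaluator of `NoiseBudget` (clean kernel reduction for `decide` certificates). -/
def noiseBudgetB (F : Finset K) (q : K → K) (G : K) : (ℕ → K) → ℕ → K → Bool
  | _, 0, _ => true
  | x, n + 1, s => decide (nodeNoise F q (fun i => x (i + 1)) n (s + x 0) ≤ G ^ 2 / 4)
      && noiseBudgetB F q G (fun i => x (i + 1)) n (up F (s + x 0))
      && noiseBudgetB F q G (fun i => x (i + 1)) n (dn F (s + x 0))

omit [IsStrictOrderedRing K] in
/-- `noiseBudgetB` computes `NoiseBudget`. -/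
theorem noiseBudgetB_iff (F : Finset K) (q : K → K) (G : K) (x : ℕ → K) (n : ℕ) (s : K) :
    noiseBudgetB F q G x n s = true ↔ NoiseBudget F q G x n s := by
  induction n generalizing x s with
  | zero => simp [noiseBudgetB, NoiseBudget]
  | succ n ih => simp [noiseBudgetB, NoiseBudget, ih, Bool.and_eq_true, and_assoc]

/-- `NoiseBudget` is decidable (via `noiseBudgetB`). -/
instance instDecidableNoiseBudget (F : Finset K) (q : K → K) (G : K) (x : ℕ → K) (n : ℕ) (s : K) :
    Decidable (NoiseBudget F q G x n s) :=
  decidable_of_iff _ (noiseBudgetB_iff F q G x n s)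

/-- **Local budget ⇒ global bound**: `NoiseBudget G ⇒ 𝒩 ≤ n·G²/4` (the up-probabilities are
probabilities). -/
theorem noiseQ_le_of_noiseBudget (F : Finset K) {q : K → K}
    (hq01 : ∀ η, 0 ≤ η → η ≤ 1 → 0 ≤ q η ∧ q η ≤ 1) {G : K} :
    ∀ (x : ℕ → K) (n : ℕ) (s : K),
      NoiseBudget F q G x n s → noiseQ F q x n s ≤ n * (G ^ 2 / 4) := by
  intro x n
  induction n generalizing x with
  | zero => intro s _; simp [noiseQ]
  | succ n ih =>
    rintro s ⟨h0, hu, hd⟩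
    simp only [noiseQ, stepQ]
    obtain ⟨hp0, hp1⟩ := pUpQ_mem F hq01 (s + x 0)
    have a1 := mul_le_mul_of_nonneg_left (ih _ _ hu) hp0
    have a2 := mul_le_mul_of_nonneg_left (ih _ _ hd) (sub_nonneg.mpr hp1)
    push_cast
    linarith

/-- **The Pythagorean law from the local noise budget**: `NoSat ∧ GapLE G ∧ NoiseBudget G ⇒
E(ŝₙ − sₙ)² ≤ n·G²/4 + (n·ε·G)²`, for every admissible rule `q`, on any value set, any window, any
sign pattern. -/
theorem accExpQ_sq_le_of_noiseBudget (F : Finset K) {q : K → K} {ε G : K}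
    (hq01 : ∀ η, 0 ≤ η → η ≤ 1 → 0 ≤ q η ∧ q η ≤ 1) (hq : ∀ η, 0 ≤ η → η ≤ 1 → |q η - η| ≤ ε)
    (x : ℕ → K) (n : ℕ) (s : K) (hns : NoSat F x n s) (hgap : GapLE F G x n s)
    (hb : NoiseBudget F q G x n s) :
    accExpQ F q x n (fun t => (t - (s + ∑ i ∈ range n, x i)) ^ 2) s
      ≤ n * (G ^ 2 / 4) + (n * (ε * G)) ^ 2 :=
  accExpQ_sq_le_of_noiseQ_le F hq01 hq x n s hns hgap (noiseQ_le_of_noiseBudget F hq01 x n s hb)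

/-- **`GapLE G ∧ DriftAntitone ⇒ NoiseBudget G`**: `Δ ≤ 0` makes the cross term nonpositive,
`π(1−π) ≤ 1/4` and `w ≤ G` bound the variance term. -/
theorem noiseBudget_of_driftAntitone (F : Finset K) {q : K → K}
    (hq01 : ∀ η, 0 ≤ η → η ≤ 1 → 0 ≤ q η ∧ q η ≤ 1) {G : K} :
    ∀ (x : ℕ → K) (n : ℕ) (s : K), GapLE F G x n s → DriftAntitone F q x n s →
      NoiseBudget F q G x n s := by
  intro x n
  induction n generalizing x with
  | zero => intro s _ _; trivial
  | succ n ih =>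
    rintro s ⟨hg0, hgu, hgd⟩ ⟨hΔ, hau, had⟩
    refine ⟨?_, ih _ _ hgu hau, ih _ _ hgd had⟩
    have hγ : up F (s + x 0) - dn F (s + x 0) ≤ G := hg0
    have hγ0 : 0 ≤ up F (s + x 0) - dn F (s + x 0) := sub_nonneg.mpr (dn_le_up F _)
    obtain ⟨hp0, hp1⟩ := pUpQ_mem F hq01 (s + x 0)
    have hΔ' : driftGap F q (fun i => x (i + 1)) n (s + x 0) ≤ 0 := by
      unfold driftGap; linarith [hΔ]
    unfold nodeNoise
    set π := pUpQ F q (s + x 0)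
    set w := up F (s + x 0) - dn F (s + x 0)
    set Δ := driftGap F q (fun i => x (i + 1)) n (s + x 0)
    clear_value π w Δ
    have h1 : π * (1 - π) ≤ 1 / 4 := by nlinarith [sq_nonneg (π - 1 / 2)]
    have h2 : 0 ≤ π * (1 - π) := mul_nonneg hp0 (sub_nonneg.mpr hp1)
    have h3 : w * (w + 2 * Δ) ≤ G ^ 2 := by nlinarith [hγ, hγ0, hΔ']
    calc π * (1 - π) * w * (w + 2 * Δ) = (π * (1 - π)) * (w * (w + 2 * Δ)) := by ring
      _ ≤ (π * (1 - π)) * G ^ 2 := mul_le_mul_of_nonneg_left h3 h2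
      _ ≤ (1 / 4) * G ^ 2 := mul_le_mul_of_nonneg_right h1 (sq_nonneg G)
      _ = G ^ 2 / 4 := by ring

/-- File XCII's theorem `accExpQ_sq_le_of_driftAntitone`, re-derived through the noise budget. -/
theorem accExpQ_sq_le_of_driftAntitone' (F : Finset K) {q : K → K} {ε G : K}
    (hq01 : ∀ η, 0 ≤ η → η ≤ 1 → 0 ≤ q η ∧ q η ≤ 1) (hq : ∀ η, 0 ≤ η → η ≤ 1 → |q η - η| ≤ ε)
    (x : ℕ → K) (n : ℕ) (s : K) (hns : NoSat F x n s) (hgap : GapLE F G x n s)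
    (ha : DriftAntitone F q x n s) : accExpQ F q x n (fun t => (t - (s + ∑ i ∈ range n, x i)) ^ 2) s
      ≤ n * (G ^ 2 / 4) + (n * (ε * G)) ^ 2 :=
  accExpQ_sq_le_of_noiseBudget F hq01 hq x n s hns hgap
    (noiseBudget_of_driftAntitone F hq01 x n s hgap ha)

section StochasticA
variable [FloorRing K]

/-- `StochasticA`, local form: `NoSat ∧ GapLE G ∧ NoiseBudget G ⇒
E(ŝₙ − sₙ)² ≤ n·G²/4 + (n·2^{-N}·G)²`. -/
theorem stochasticA_acc_sq_le_of_noiseBudget (F : Finset K) (N : ℕ) {G : K}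
    (x : ℕ → K) (n : ℕ) (s : K) (hns : NoSat F x n s) (hgap : GapLE F G x n s)
    (hb : NoiseBudget F (probAwayA N) G x n s) :
    accExpQ F (probAwayA N) x n (fun t => (t - (s + ∑ i ∈ range n, x i)) ^ 2) s
      ≤ n * (G ^ 2 / 4) + (n * (1 / 2 ^ N * G)) ^ 2 :=
  accExpQ_sq_le_of_noiseBudget F (probAwayA_mem N) (fun η _ _ => abs_probAwayA_sub_le N η) x n s
    hns hgap hb

/-- `StochasticA`, global form: `NoSat ∧ GapLE G ∧ 𝒩 ≤ n·G²/4 ⇒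
E(ŝₙ − sₙ)² ≤ n·G²/4 + (n·2^{-N}·G)²`. -/
theorem stochasticA_acc_sq_le_of_noiseQ_le (F : Finset K) (N : ℕ) {G : K}
    (x : ℕ → K) (n : ℕ) (s : K) (hns : NoSat F x n s) (hgap : GapLE F G x n s)
    (hB : noiseQ F (probAwayA N) x n s ≤ n * (G ^ 2 / 4)) :
    accExpQ F (probAwayA N) x n (fun t => (t - (s + ∑ i ∈ range n, x i)) ^ 2) s
      ≤ n * (G ^ 2 / 4) + (n * (1 / 2 ^ N * G)) ^ 2 :=
  accExpQ_sq_le_of_noiseQ_le F (probAwayA_mem N) (fun η _ _ => abs_probAwayA_sub_le N η) x n s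
    hns hgap hB

end StochasticA
end LimitedBits

namespace Formats
open LimitedBits

/-- **All six sharpness witnesses of the bits threshold satisfy the noise budget** (kernel): each
tree of `e3m2_bits_threshold_sharp` / `e2m1_two_bits_needed` (`N = J − 1` bits: NOT drift-antitone,
`superjump_witnesses_not_jumpLE`) has its `Δ > 0` at a root of width `w ≤ G/4`, node noise far
inside `G²/4`; so the law holds on them by `stochasticA_acc_sq_le_of_noiseBudget`. -/
theorem threshold_witnesses_noiseBudget :
    NoiseBudget e3m2 (probAwayA 0) 1 (seqL [5 / 4, 5 / 2]) 2 1 ∧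
    NoiseBudget e3m2 (probAwayA 1) 1 (seqL [-9 / 8, 5 / 2]) 2 3 ∧
    NoiseBudget e3m2 (probAwayA 2) 2 (seqL [1 / 8, 67 / 8]) 2 1 ∧
    NoiseBudget e3m2 (probAwayA 3) 2 (seqL [1 / 16, 135 / 16]) 2 (1 / 2) ∧
    NoiseBudget e3m2 (probAwayA 4) 2 (seqL [1 / 32, 519 / 64]) 2 0 ∧
    NoiseBudget FP4.e2m1 (probAwayA 1) 2 (seqL [1 / 8, 4]) 2 (1 / 2) := by
  refine ⟨?_, ?_, ?_, ?_, ?_, ?_⟩ <;> (rw [← noiseBudgetB_iff]; decide +kernel)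

/-- The `J = 3` witness in full (two bits, from `1` add `1/8, 67/8`, window `[1, 10]`, `G = 2`):
not drift-antitone, yet `NoiseBudget 2`, so `E(ŝ₂ − 19/2)² ≤ 3` by theorem (value `1`;
`𝒩 = 59/64`, `ℬ = 5/64`). -/
theorem e3m2_superjump_certified_by_budget :
    NoSat e3m2 (seqL [1 / 8, 67 / 8]) 2 1 ∧ GapLE e3m2 2 (seqL [1 / 8, 67 / 8]) 2 1 ∧
    ¬ DriftAntitone e3m2 (probAwayA 2) (seqL [1 / 8, 67 / 8]) 2 1 ∧
    accExpQ e3m2 (probAwayA 2) (seqL [1 / 8, 67 / 8]) 2 (fun t => (t - 19 / 2) ^ 2) 1 ≤ 3 ∧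
    accExpQ e3m2 (probAwayA 2) (seqL [1 / 8, 67 / 8]) 2 (fun t => (t - 19 / 2) ^ 2) 1 = 1 ∧
    noiseQ e3m2 (probAwayA 2) (seqL [1 / 8, 67 / 8]) 2 1 = 59 / 64 ∧
    bias2Q e3m2 (probAwayA 2) (seqL [1 / 8, 67 / 8]) 2 1 = 5 / 64 := by
  have hns : NoSat e3m2 (seqL [1 / 8, 67 / 8]) 2 1 := by rw [← noSatB_iff]; decide +kernel
  have hg : GapLE e3m2 2 (seqL [1 / 8, 67 / 8]) 2 1 := by rw [← gapLEB_iff]; decide +kernel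
  have hS : (1 : ℚ) + ∑ i ∈ range 2, seqL [1 / 8, 67 / 8] i = 19 / 2 := by
    norm_num [seqL, Finset.sum_range_succ]
  have hlaw := stochasticA_acc_sq_le_of_noiseBudget e3m2 2 (seqL [1 / 8, 67 / 8]) 2 1 hns hg
    threshold_witnesses_noiseBudget.2.2.1
  rw [hS] at hlaw
  refine ⟨hns, hg, ?_, hlaw.trans (le_of_eq (by norm_num)), by decide +kernel, by decide +kernel,
    by decide +kernel⟩
  rw [← driftAntitoneB_iff]; decide +kernel

/-- Witness summands `57/8, −53/8, 113/16` (three additions from `2`; exact sum `153/16`). -/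
def xNB : ℕ → ℚ := seqL [57 / 8, -53 / 8, 113 / 16]

/-- **The local budget is NOT a theorem for two random bits; the global criterion certifies the
tree** (kernel).  E3M2, `StochasticA`, `N = 2`, from `2` add `57/8, −53/8, 113/16`: one-signed
window `[1, 12]` (spacings `1/4 … 2`, `G = 2`), no saturation, gaps `≤ 2`.  The root (`c = 73/8` in
the cell `[8, 10]`, `π = 1/2`) has sibling drift gap `Δ = +1/8` — the second summand drops both
siblings to cells finer by `3 > N` and `2` binades, the third lifts them back misaligned — so
`nodeNoise = ½·½·2·(2 + ¼) = 9/8 > 1 = G²/4`: `¬ NoiseBudget`.  Globally the fine second step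
under-spends: `𝒩 = 105/64 ≤ 3 = 3·G²/4`, and the law `E(ŝ₃ − s₃)² ≤ 3 + (3·¼·2)² = 21/4` follows
from `stochasticA_acc_sq_le_of_noiseQ_le` (actual value `439/256`). -/
theorem e3m2_noiseBudget_fails_noiseQ_le :
    InWindow e3m2 1 12 xNB 3 2 ∧ NoSat e3m2 xNB 3 2 ∧ GapLE e3m2 2 xNB 3 2 ∧
    ¬ DriftAntitone e3m2 (probAwayA 2) xNB 3 2 ∧
    ¬ NoiseBudget e3m2 (probAwayA 2) 2 xNB 3 2 ∧
    nodeNoise e3m2 (probAwayA 2) (fun i => xNB (i + 1)) 2 (2 + xNB 0) = 9 / 8 ∧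
    noiseQ e3m2 (probAwayA 2) xNB 3 2 = 105 / 64 ∧
    noiseQ e3m2 (probAwayA 2) xNB 3 2 ≤ (3 : ℕ) * ((2 : ℚ) ^ 2 / 4) ∧
    accExpQ e3m2 (probAwayA 2) xNB 3 (fun t => (t - 153 / 16) ^ 2) 2 ≤ 21 / 4 ∧
    accExpQ e3m2 (probAwayA 2) xNB 3 (fun t => (t - 153 / 16) ^ 2) 2 = 439 / 256 := by
  have hns : NoSat e3m2 xNB 3 2 := by rw [← noSatB_iff]; decide +kernel
  have hg : GapLE e3m2 2 xNB 3 2 := by rw [← gapLEB_iff]; decide +kernel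
  have hB : noiseQ e3m2 (probAwayA 2) xNB 3 2 ≤ (3 : ℕ) * ((2 : ℚ) ^ 2 / 4) := by decide +kernel
  have hS : (2 : ℚ) + ∑ i ∈ range 3, xNB i = 153 / 16 := by
    norm_num [xNB, seqL, Finset.sum_range_succ]
  have hlaw := stochasticA_acc_sq_le_of_noiseQ_le e3m2 2 xNB 3 2 hns hg hB
  rw [hS] at hlaw
  refine ⟨?_, hns, hg, ?_, ?_, by decide +kernel, by decide +kernel, hB,
    hlaw.trans (le_of_eq (by norm_num)), by decide +kernel⟩
  · rw [← inWindowB_iff]; decide +kernel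
  · rw [← driftAntitoneB_iff]; decide +kernel
  · rw [← noiseBudgetB_iff]; decide +kernel

/-- **The global criterion is attained** (E3M2, two bits): from `1` add `175/128, 27/32, 37/128` —
three fair coins in the equally spaced window `[2, 4]` (`G = 1/2`): `𝒩 = 3/16 = 3·G²/4` exactly
(`ℬ = 1/16`, `E e² = 1/4 ≤ 21/64`). -/
theorem e3m2_noiseQ_attains :
    InWindow e3m2 2 4 (seqL [175 / 128, 27 / 32, 37 / 128]) 3 1 ∧
    noiseQ e3m2 (probAwayA 2) (seqL [175 / 128, 27 / 32, 37 / 128]) 3 1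
      = (3 : ℕ) * (((1 : ℚ) / 2) ^ 2 / 4) ∧
    bias2Q e3m2 (probAwayA 2) (seqL [175 / 128, 27 / 32, 37 / 128]) 3 1 = 1 / 16 := by
  refine ⟨?_, by decide +kernel, by decide +kernel⟩
  rw [← inWindowB_iff]; decide +kernel

end Formats

end Summit.Ventures.CertifiedArithmetic.LowPrec.SR
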